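import Summits.HodgeConjecture.HodgeConjecture.Theorems.HLiu418UndoublingMirror
import Summits.HodgeConjecture.HodgeConjecture.Theorems.H413MirrorAtPinLine
import Literature.NumberTheory.GelbartRogawski1991.DoubledWeilRepresentationUniqueness
import Literature.NumberTheory.Automorphic.ConjugateSelfDualLocalValues
import Literature.NumberTheory.Automorphic.IdeleClassCharacterConjugate
import HarnessLib

/-!
# The `χ`-attached splitting of the MIRROR line is the complex conjugate of the `χ`-attached splitting:
# `ι_{χ⁻¹}(dW′) = splittingCongr (mirrorSplitting ι_χ(dW))` (`dW′ = −dW`), and the conjugate partner `\overline{ω(μ,⟨a⟩,χ)} ≅ ω(μᶜ,⟨−a⟩,χ̄)` in every rank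

Cell `hodgecm-mathlib`, floor 0, programme P5 (`Cruxes/HLiu418/Lines/F0_AlbCm.lean`), crux item `stmt-HodgeConjecture-24832`; K-E3 lane, ROAD U
steps (U2) + (U4).  THEOREMS ONLY (no definition, no named fact, no instance, no `sorry`); rank-GENERIC (`N` arbitrary, `M = 1` in §2–§3).

* §1 **`chiSplitting_mirror`** (U2): for UNITARY `χ` with `χ|_{𝕀_{L⁺}} = ε` and `realDiagonal dW′ = −realDiagonal dW`,
  `splittingCongr (mirrorSplitting (chiSplitting χ dW)) = chiSplitting χ⁻¹ dW′` — by the UNIQUENESS of the `χ⁻¹`-normalised doubled Weil representation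
  (★ `undoubleHom_unique`, [Kudla1994, Thm. 3.1]): both the mirror `mpCongr ∘ (·)ᶜ ∘ s^𝔻_χ ∘ (H′ = H)` (★ `isDoubledWeilRep_mirror_subgroupCongr`) and
  `s^𝔻_{χ⁻¹}` are `χ⁻¹`-normalised at `dW′`, and undoubling commutes with the mirror (★ `undoubleHom_mirror`).  No central-type dictionary and no
  `CentralCharFactorsThroughDet` (the rank-`≥ 3` input of ★ `H413MirrorSplittingAtScalar`) is used: this is the road that works for the CURVES (`N = 2`).
* §2 the hermitian LINE `⟨a⟩`, `a ∈ (L⁺)ˣ`: `−TW a = TW (−a)`, `−JW a = JW (−a)` (unbundled twins of ★ `H413MirrorAtPinLine.neg_TW_eq ∕ neg_JW_eq`) and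
  **`mirror_chiSplittingLine`**: `splittingCongr (mirrorSplitting (chiSplittingLine χ (TW a) (JW a))) = chiSplittingLine χ₂ (TW (−a)) (JW (−a))` for `χ₂ = χ⁻¹`.
* §3 **`exists_conjPartner_omegaAtLine_neg`** (U4): for `μ` conjugate symplectic OF WEIGHT ONE, a unit `a` and `χ ∈ Chi`, with `μ′ := μᶜ` (conjugate symplectic
  of weight one, `Φ_{μᶜ} = Φ̄_μ`, ★ `IsConjugateSymplectic.cmType_galConj`; `toHecke μᶜ = (toHecke μ)⁻¹`, ★ `toHeckeCharacter_galConj_complexConj`):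
  a BIJECTIVE CONJUGATE-LINEAR `J : ω(μ, ⟨a⟩, χ) → ω(μᶜ, ⟨−a⟩, χ̄)` with `J ∘ rhoVAtLine a χ k = rhoVAtLine (−a) χ̄ k ∘ J` for every `k ∈ U(diag dV)(𝔸_f)`
  (★ `exists_coinv_semilinear_mirror_cast`) — [Liu2021, App. D Lem. D.1 (2)] «`\overline{ω(μ,ε,χ)} ≅ ω(μᶜ, −ε, χ⁻¹)`» at the tree's carriers, in the
  currency of the E3 letters (`isCompatible_chiSplittingLine … (toHeckeCharacter L μ) …`), EVERY rank `N`.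

HC_CM is proved only modulo the 7 printed citations (+ declared floor-0 debt) until rung 0 closes; this file proves nothing about them.

## References
* [Liu2021] Y. Liu, Camb. J. Math. 9 (2021) = arXiv:2102.11518: Def. 4.11–4.12, Rem. 4.4, App. D §D.1 Steps 1–3, Lem. D.1 (2).
* [Kudla1994] S. Kudla, Israel J. Math. 87 (1994), §3 Thm. 3.1.  [GelbartRogawski1991] Invent. Math. 105 (1991), §3.1 Prop. 3.1.1 p. 455, Remark p. 457.
* [Li1992] J.-S. Li, J. reine angew. Math. 428 (1992), p. 181.  [MoeglinVignerasWaldspurger1987] LNM 1291, Chap. 2 II.1, Chap. 3 IV.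
-/

set_option autoImplicit false
set_option linter.dupNamespace false

noncomputable section

open scoped Classical
open scoped Matrix ComplexConjugate
open NumberField IsDedekindDomain
open Literature.RepresentationTheory.HeisenbergGroup
open Literature.NumberTheory.Automorphic
open Literature.NumberTheory.Weil1964
open Literature.NumberTheory.GaloisRepresentations
open Literature.NumberTheory.GelbartRogawski1991 Literature.NumberTheory.GelbartRogawski1991.UnitaryDualPair
open Literature.NumberTheory.GelbartRogawski1991.UnitaryDualPair.WeilCoinv
open Literature.NumberTheory.GelbartRogawski1991.GRConstruction
open Literature.NumberTheory.Automorphic.UnitaryGroup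
open Literature.NumberTheory.Automorphic.IdeleClassGroup
open Literature.NumberTheory.Automorphic.Liu2021 Literature.NumberTheory.Automorphic.Liu2021.Def411WeilCarriers
open Literature.NumberTheory.Automorphic.Liu2021.Def411WeilCarriersDoubling
open Literature.RepresentationTheory.Liu2021 Literature.RepresentationTheory.HarrisKudlaSweet1996
open HodgeCM.WeilCoinv (mirrorSplitting mirrorSplitting_apply adelicGram_neg)
open Summit.HodgeConjecture.HodgeConjecture.Cruxes.H413.MirrorAtPinLine (splittingCongr_splittingCongr mirrorSplitting_splittingCongr
  exists_coinv_semilinear_mirror_cast lineChar_eq_of_val_eq)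

namespace Summit.HodgeConjecture.HodgeConjecture.Cruxes.HLiu418.DoubledWeilMirror

variable (L : Type) [Field L] [NumberField L] [IsCMField L]

/-! ## §1 `ι_{χ⁻¹}(dW′)` is the mirror of `ι_χ(dW)` -/

section ChiSplitting

variable {N M n : ℕ} (e : Fin N × Fin M ≃ Fin n)
  (dV : Fin N → L) (hdV : ∀ i, IsCMField.complexConj L (dV i) = dV i) (hdV0 : ∀ i, dV i ≠ 0)
  {dW : Fin M → L} {hdW : ∀ i, IsCMField.complexConj L (dW i) = dW i} (hdW0 : ∀ i, dW i ≠ 0)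
  {dW' : Fin M → L} {hdW' : ∀ i, IsCMField.complexConj L (dW' i) = dW' i} (hdW0' : ∀ i, dW' i ≠ 0)

set_option maxHeartbeats 4000000 in
-- (both `chiSplitting`s unfold to `undoubleHom`s of the chosen doubled Weil representations; the telescopes of both data)
/-- **(U2) THE `χ⁻¹`-ATTACHED SPLITTING OF THE MIRROR LINE IS THE COMPLEX CONJUGATE OF THE `χ`-ATTACHED SPLITTING**: for unitary `χ` with
`χ|_{𝕀_{L⁺}} = ε`, `χ₂ = χ⁻¹` and `realDiagonal dW′ = −realDiagonal dW`, `splittingCongr (mirrorSplitting (ι_χ(dW))) = ι_{χ₂}(dW′)` — uniqueness of the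
`χ⁻¹`-normalised doubled Weil representation [Kudla1994, Thm. 3.1] (★ `undoubleHom_unique`) applied to the mirror of `s^𝔻_χ` (★ `isDoubledWeilRep_mirror_subgroupCongr`)
and `s^𝔻_{χ⁻¹}`, plus ★ `undoubleHom_mirror`.  [Liu2021, App. D Lem. D.1 (2)] at the level of the `μ`-attached splittings `ι_μ` of Step 2, every rank.
[cite: Kudla1994, §3 Thm. 3.1] [cite: GelbartRogawski1991, §3.1 Prop. 3.1.1 p. 455 L1–2, Remark p. 457 L4–13] [cite: Liu2021, App. D Lemma D.1 (2) (l. 5231)] -/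
theorem chiSplitting_mirror (hneg : realDiagonal L dW' hdW' = -realDiagonal L dW hdW) (χ χ₂ : HeckeCharacter L)
    (hχu : χ.IsUnitary) (hχs : IsSplittingChar L 1 χ) (hχu₂ : χ₂.IsUnitary) (hχs₂ : IsSplittingChar L 1 χ₂) (hχ₂ : χ₂ = χ⁻¹) :
    splittingCongr (Fp L) L (IsCMField.complexConj L) N M e (Matrix.diagonal dV) hneg.symm (neg_diagonal_eq hneg)
        (mirrorSplitting (Fp L) L (IsCMField.complexConj L) N M e (Matrix.diagonal dV) (Matrix.diagonal dW)
          (chiSplitting L e dV hdV hdV0 dW hdW hdW0 χ hχu hχs)) =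
      chiSplitting L e dV hdV hdV0 dW' hdW' hdW0' χ₂ hχu₂ hχs₂ := by
  subst hχ₂
  exact (undoubleHom_mirror hdV0 hdW0 hdW0' hneg χ hχu (isDoubledWeilRep_doubledWeilRep L e dV hdV hdV0 dW hdW hdW0 χ hχu hχs)).symm.trans
    (DoubledWeilUniqueness.undoubleHom_unique L e dV hdV hdV0 dW' hdW' hdW0' χ⁻¹
      (isDoubledWeilRep_mirror_subgroupCongr hdV0 hdW0 hdW0' hneg χ hχu (isDoubledWeilRep_doubledWeilRep L e dV hdV hdV0 dW hdW hdW0 χ hχu hχs))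
      (isDoubledWeilRep_doubledWeilRep L e dV hdV hdV0 dW' hdW' hdW0' χ⁻¹ hχu₂ hχs₂))

end ChiSplitting

/-! ## §2 The hermitian line `⟨a⟩` and its mirror `⟨−a⟩` -/

section Line

omit [NumberField L] [IsCMField L] in
/-- `−TW a = TW (−a)` (unbundled twin of ★ `H413MirrorAtPinLine.neg_TW_eq`). [cite: Liu2021, App. D §D.1 Step 1 (l. 5215)] -/
theorem neg_TW (a : (↥(maximalRealSubfield L))ˣ) : -TW (↥(maximalRealSubfield L)) a = TW (↥(maximalRealSubfield L)) (-a) := by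
  refine Matrix.ext fun i j => ?_
  rw [Subsingleton.elim i 0, Subsingleton.elim j 0, Matrix.neg_apply]
  show -((a : ↥(maximalRealSubfield L))) = (((-a : (↥(maximalRealSubfield L))ˣ)) : ↥(maximalRealSubfield L))
  rw [Units.val_neg]

omit [NumberField L] [IsCMField L] in
/-- `−JW a = JW (−a)`. [cite: Liu2021, App. D §D.1 Step 1 (l. 5215)] -/
theorem neg_JW (a : (↥(maximalRealSubfield L))ˣ) :
    -JW (↥(maximalRealSubfield L)) L a = JW (↥(maximalRealSubfield L)) L (-a) := by
  rw [JW_eq, JW_eq, ← neg_TW, Matrix.map_neg _ (map_neg _)]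

/-- the Gram vectors of the lines `⟨−a⟩` and `⟨a⟩`: `realDiagonal (lineW (TW (−a))) = −realDiagonal (lineW (TW a))`. [cite: Liu2021, App. D §D.1 Step 1 (l. 5215)] -/
theorem realDiagonal_lineW_neg (a : (↥(maximalRealSubfield L))ˣ) :
    realDiagonal L (lineW L (TW (↥(maximalRealSubfield L)) (-a))) (complexConj_lineW L (TW (↥(maximalRealSubfield L)) (-a))) =
      -realDiagonal L (lineW L (TW (↥(maximalRealSubfield L)) a)) (complexConj_lineW L (TW (↥(maximalRealSubfield L)) a)) := by
  rw [realDiagonal_lineW, realDiagonal_lineW, neg_TW]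

variable {N' n' : ℕ} (e₁ : Fin N' × Fin 1 ≃ Fin n')
  (dV : Fin N' → L) (hdV : ∀ i, IsCMField.complexConj L (dV i) = dV i) (hdV0 : ∀ i, dV i ≠ 0)

set_option maxHeartbeats 4000000 in
-- (four casts through the `splittingDatum` telescope)
/-- **THE MIRROR OF `ι_χ` AT THE LINE `⟨a⟩` IS `ι_{χ⁻¹}` AT `⟨−a⟩`**: `splittingCongr (mirrorSplitting (chiSplittingLine χ (TW a) (JW a))) =
chiSplittingLine χ₂ (TW (−a)) (JW (−a))` for `χ₂ = χ⁻¹` (§1 at `dW := lineW (TW a)`, `dW′ := lineW (TW (−a))`, and the cast algebra ★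
`mirrorSplitting_splittingCongr` ∕ `splittingCongr_splittingCongr`). [cite: Liu2021, App. D Lemma D.1 (2) (l. 5231); §D.1 Steps 1–2 (l. 5215–5219)]
[cite: Kudla1994, §3 Thm. 3.1] -/
theorem mirror_chiSplittingLine (χ χ₂ : HeckeCharacter L) (hχu : χ.IsUnitary) (hχs : IsSplittingChar L 1 χ) (hχu₂ : χ₂.IsUnitary)
    (hχs₂ : IsSplittingChar L 1 χ₂) (hχ₂ : χ₂ = χ⁻¹) (a : (↥(maximalRealSubfield L))ˣ) :
    splittingCongr (Fp L) L (IsCMField.complexConj L) N' 1 e₁ (Matrix.diagonal dV) (neg_TW L a) (neg_JW L a)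
        (mirrorSplitting (Fp L) L (IsCMField.complexConj L) N' 1 e₁ (Matrix.diagonal dV) (JW (↥(maximalRealSubfield L)) L a)
          (chiSplittingLine L e₁ dV hdV hdV0 χ hχu hχs (TW (↥(maximalRealSubfield L)) a) (isUnit_det_TW (↥(maximalRealSubfield L)) a)
            (JW (↥(maximalRealSubfield L)) L a) (JW_eq (↥(maximalRealSubfield L)) L a))) =
      chiSplittingLine L e₁ dV hdV hdV0 χ₂ hχu₂ hχs₂ (TW (↥(maximalRealSubfield L)) (-a)) (isUnit_det_TW (↥(maximalRealSubfield L)) (-a))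
        (JW (↥(maximalRealSubfield L)) L (-a)) (JW_eq (↥(maximalRealSubfield L)) L (-a)) := by
  -- §1 at the Gram vectors `dW := lineW (TW a)`, `dW′ := lineW (TW (−a))`
  have h1 := chiSplitting_mirror L e₁ dV hdV hdV0 (lineW_ne_zero L _ (isUnit_det_TW (↥(maximalRealSubfield L)) a))
    (lineW_ne_zero L _ (isUnit_det_TW (↥(maximalRealSubfield L)) (-a))) (realDiagonal_lineW_neg L a) χ χ₂ hχu hχs hχu₂ hχs₂ hχ₂
  -- `chiSplittingLine` unfolds to a cast of `chiSplitting`; compose the casts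
  unfold chiSplittingLine
  rw [mirrorSplitting_splittingCongr, splittingCongr_splittingCongr, ← h1, splittingCongr_splittingCongr]

end Line

/-! ## §3 The conjugate partner of `ω(μ, ⟨a⟩, χ)` at the mirror line, in the currency of the E3 letters (every rank) -/

section Partner

variable {N' n' : ℕ} (e₁ : Fin N' × Fin 1 ≃ Fin n')
  (dV : Fin N' → L) (hdV : ∀ i, IsCMField.complexConj L (dV i) = dV i) (hdV0 : ∀ i, dV i ≠ 0)

set_option maxHeartbeats 4000000 in
/-- **(U4) THE CONJUGATE PARTNER AT THE MIRROR LINE.**  For `μ` conjugate symplectic OF WEIGHT ONE, a unit `a ∈ (L⁺)ˣ` and `χ ∈ Chi`: with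
`μ′ := μᶜ` (conjugate symplectic of weight one, `Φ_{μ′} = Φ̄_μ`) there is a BIJECTIVE CONJUGATE-LINEAR map `J : ω(μ, ⟨a⟩, χ) → ω(μ′, ⟨−a⟩, χ̄)`
(`χ̄ = conj ∘ χ`; the carriers `omegaAtLine` of [Liu2021, Def. 4.11] at the splittings `ι_{toHecke μ}`, `ι_{toHecke μ′}` in the currency
`isCompatible_chiSplittingLine`) with `J (rhoVAtLine a χ k x) = rhoVAtLine (−a) χ̄ k (J x)` for every `k ∈ U(diag dV)(𝔸_f)` — complex conjugation of finite
Schwartz functions, descended (★ `exists_coinv_semilinear_mirror_cast`) on the identified mirror splitting (§2 + `toHecke μᶜ = (toHecke μ)⁻¹`).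
[Liu2021, App. D Lem. D.1 (2)] «`\overline{ω(μ,ε,χ)} ≅ ω(μᶜ, −ε, χ⁻¹)`» at the tree's objects, at the representative `−a`, EVERY rank.
[cite: Liu2021, Def. 4.11 (l. 2092–2096), App. D Lemma D.1 (2) (l. 5231), Remark 4.4] [cite: GelbartRogawski1991, §3.1 Prop. 3.1.1 p. 455, Remark p. 457]
[cite: Li1992, p. 181] -/
theorem exists_conjPartner_omegaAtLine_neg
    (lam : Literature.NumberTheory.Automorphic.IdeleClassGroup L →ₜ* Circle) (hlam : IsConjugateSymplectic L lam) (hw : HasWeight L lam 1)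
    (a : (↥(maximalRealSubfield L))ˣ) (χ : Chi (↥(maximalRealSubfield L)) L (IsCMField.complexConj L)) :
    ∃ (lam' : Literature.NumberTheory.Automorphic.IdeleClassGroup L →ₜ* Circle) (hlam' : IsConjugateSymplectic L lam'),
      HasWeight L lam' 1 ∧ hlam'.cmType = Literature.NumberTheory.ComplexMultiplication.CMTypeOps.bar hlam.cmType ∧
      ∃ J : omegaAtLine (↥(maximalRealSubfield L)) L (IsCMField.complexConj L) N' e₁ (Matrix.diagonal dV)
            (complexConj_imagUnit L) (imagUnit_ne_zero L) (imagUnit_mul_self L) (realDiagonal_isSymm L dV hdV)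
            (isUnit_det_realDiagonal L dV hdV hdV0) (realDiagonal_map L dV hdV).symm
            (fun a => isCompatible_chiSplittingLine L e₁ dV hdV hdV0 (toHeckeCharacter L lam)
              (isUnitary_toHeckeCharacter L lam) ((isOscillatorChar_toHeckeCharacter_iff lam).mpr hlam)
              (TW (↥(maximalRealSubfield L)) a) (isSymm_TW (↥(maximalRealSubfield L)) a)
              (isUnit_det_TW (↥(maximalRealSubfield L)) a) (JW (↥(maximalRealSubfield L)) L a)
              (JW_eq (↥(maximalRealSubfield L)) L a)) a χ →ₛₗ[starRingEnd ℂ]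
          omegaAtLine (↥(maximalRealSubfield L)) L (IsCMField.complexConj L) N' e₁ (Matrix.diagonal dV)
            (complexConj_imagUnit L) (imagUnit_ne_zero L) (imagUnit_mul_self L) (realDiagonal_isSymm L dV hdV)
            (isUnit_det_realDiagonal L dV hdV hdV0) (realDiagonal_map L dV hdV).symm
            (fun a => isCompatible_chiSplittingLine L e₁ dV hdV hdV0 (toHeckeCharacter L lam')
              (isUnitary_toHeckeCharacter L lam') ((isOscillatorChar_toHeckeCharacter_iff lam').mpr hlam')
              (TW (↥(maximalRealSubfield L)) a) (isSymm_TW (↥(maximalRealSubfield L)) a)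
              (isUnit_det_TW (↥(maximalRealSubfield L)) a) (JW (↥(maximalRealSubfield L)) L a)
              (JW_eq (↥(maximalRealSubfield L)) L a)) (-a)
            ⟨(Units.map ((starRingEnd ℂ : ℂ →+* ℂ) : ℂ →* ℂ)).comp χ.1,
              isAutomorphicOneChar_unitsMap_comp_chi (IsCMField.complexConj L) χ _⟩,
        Function.Bijective J ∧
        ∀ (k : finAdelic (↥(maximalRealSubfield L)) L (IsCMField.complexConj L) N' (Matrix.diagonal dV)) x,
          J (rhoVAtLine (↥(maximalRealSubfield L)) L (IsCMField.complexConj L) N' e₁ (Matrix.diagonal dV)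
              (complexConj_imagUnit L) (imagUnit_ne_zero L) (imagUnit_mul_self L) (realDiagonal_isSymm L dV hdV)
              (isUnit_det_realDiagonal L dV hdV hdV0) (realDiagonal_map L dV hdV).symm
              (fun a => isCompatible_chiSplittingLine L e₁ dV hdV hdV0 (toHeckeCharacter L lam)
                (isUnitary_toHeckeCharacter L lam) ((isOscillatorChar_toHeckeCharacter_iff lam).mpr hlam)
                (TW (↥(maximalRealSubfield L)) a) (isSymm_TW (↥(maximalRealSubfield L)) a)
                (isUnit_det_TW (↥(maximalRealSubfield L)) a) (JW (↥(maximalRealSubfield L)) L a)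
                (JW_eq (↥(maximalRealSubfield L)) L a)) a χ k x) =
            rhoVAtLine (↥(maximalRealSubfield L)) L (IsCMField.complexConj L) N' e₁ (Matrix.diagonal dV)
              (complexConj_imagUnit L) (imagUnit_ne_zero L) (imagUnit_mul_self L) (realDiagonal_isSymm L dV hdV)
              (isUnit_det_realDiagonal L dV hdV hdV0) (realDiagonal_map L dV hdV).symm
              (fun a => isCompatible_chiSplittingLine L e₁ dV hdV hdV0 (toHeckeCharacter L lam')
                (isUnitary_toHeckeCharacter L lam') ((isOscillatorChar_toHeckeCharacter_iff lam').mpr hlam')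
                (TW (↥(maximalRealSubfield L)) a) (isSymm_TW (↥(maximalRealSubfield L)) a)
                (isUnit_det_TW (↥(maximalRealSubfield L)) a) (JW (↥(maximalRealSubfield L)) L a)
                (JW_eq (↥(maximalRealSubfield L)) L a)) (-a)
              ⟨(Units.map ((starRingEnd ℂ : ℂ →+* ℂ) : ℂ →* ℂ)).comp χ.1,
                isAutomorphicOneChar_unitsMap_comp_chi (IsCMField.complexConj L) χ _⟩ k (J x) := by
  refine ⟨galConj (IsCMField.complexConj L) lam, hlam.galConj, hw.galConj_complexConj, hlam.cmType_galConj, ?_⟩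
  -- the mirror of `ι_{toHecke μ}` at `⟨a⟩` is `ι_{toHecke μᶜ}` at `⟨−a⟩` (`toHecke μᶜ = (toHecke μ)⁻¹`)
  have hss := mirror_chiSplittingLine L e₁ dV hdV hdV0 (toHeckeCharacter L lam) (toHeckeCharacter L (galConj (IsCMField.complexConj L) lam))
    (isUnitary_toHeckeCharacter L lam) ((isOscillatorChar_toHeckeCharacter_iff lam).mpr hlam)
    (isUnitary_toHeckeCharacter L _) ((isOscillatorChar_toHeckeCharacter_iff _).mpr hlam.galConj)
    hlam.toHeckeCharacter_galConj_complexConj a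
  obtain ⟨J, hJb, -, hJeq⟩ := exists_coinv_semilinear_mirror_cast (↥(maximalRealSubfield L)) L (IsCMField.complexConj L)
    N' 1 e₁ (Matrix.diagonal dV) (JW (↥(maximalRealSubfield L)) L a)
    (complexConj_imagUnit L) (imagUnit_ne_zero L) (imagUnit_mul_self L)
    (realDiagonal_isSymm L dV hdV) (isSymm_TW (↥(maximalRealSubfield L)) a)
    (isUnit_det_realDiagonal L dV hdV hdV0) (isUnit_det_TW (↥(maximalRealSubfield L)) a)
    (realDiagonal_map L dV hdV).symm (JW_eq (↥(maximalRealSubfield L)) L a)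
    (isCompatible_chiSplittingLine L e₁ dV hdV hdV0 (toHeckeCharacter L lam) (isUnitary_toHeckeCharacter L lam)
      ((isOscillatorChar_toHeckeCharacter_iff lam).mpr hlam) (TW (↥(maximalRealSubfield L)) a) (isSymm_TW (↥(maximalRealSubfield L)) a)
      (isUnit_det_TW (↥(maximalRealSubfield L)) a) (JW (↥(maximalRealSubfield L)) L a) (JW_eq (↥(maximalRealSubfield L)) L a))
    (neg_TW L a) (neg_JW L a) (isSymm_TW (↥(maximalRealSubfield L)) (-a)) (isUnit_det_TW (↥(maximalRealSubfield L)) (-a))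
    (JW_eq (↥(maximalRealSubfield L)) L (-a)) _ hss
    (isCompatible_chiSplittingLine L e₁ dV hdV hdV0 (toHeckeCharacter L (galConj (IsCMField.complexConj L) lam))
      (isUnitary_toHeckeCharacter L _) ((isOscillatorChar_toHeckeCharacter_iff _).mpr hlam.galConj)
      (TW (↥(maximalRealSubfield L)) (-a)) (isSymm_TW (↥(maximalRealSubfield L)) (-a)) (isUnit_det_TW (↥(maximalRealSubfield L)) (-a))
      (JW (↥(maximalRealSubfield L)) L (-a)) (JW_eq (↥(maximalRealSubfield L)) L (-a)))
    (lineChar (↥(maximalRealSubfield L)) L (IsCMField.complexConj L) a χ.1)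
    (lineChar (↥(maximalRealSubfield L)) L (IsCMField.complexConj L) (-a) ((Units.map ((starRingEnd ℂ : ℂ →+* ℂ) : ℂ →* ℂ)).comp χ.1))
    (fun u u₂ hu => lineChar_eq_of_val_eq (↥(maximalRealSubfield L)) L (IsCMField.complexConj L) a (-a) χ.1
      ((starRingEnd ℂ : ℂ →+* ℂ) : ℂ →* ℂ) u u₂ hu)
  exact ⟨J, hJb, hJeq⟩

end Partner

end Summit.HodgeConjecture.HodgeConjecture.Cruxes.HLiu418.DoubledWeilMirror

end
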